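import Summits.MatrixMultiplication.MatrixMultiplication.Theorems.OutsiderSandwichColumnDisjoint
import HarnessLib

/-!
# Relative sign-untwisting: the gauge-fixed form of the column-disjoint no-go

Route `OutsiderSandwich` (decomposition cell `decomp-mm`, lens 4 «minimal counterexample /
extremal reduction», gen 27, kernel 7), support for the aside leaf `BlockOneIsMM`
(stmt-MatrixMultiplication-27147); cut of record untouched; theorem-only.

## Why

`OutsiderSandwichColumnDisjoint.four_pow_le_card_mul_three_pow` prices column-disjoint
certificates whose wired blocks `(i, c)` are SIGN-UNTWISTED in the ABSOLUTE sense
`τ_c (A_i X) = ε • A_i X`.  That hypothesis is not invariant under RELABELLING the blocks of a copy: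
pre-twisting the `x`-leg, `A_i := τ_{c₀}`, makes block `c₀` compute `τ_{c₀}(τ_{c₀} X) · v = X · v`
— perfectly productive — while `τ_{c₀}` is not a scalar on `range A_i = M_{2^N}`
(`pretwist_not_signUntwisted`), so the absolute no-go is silent about a certificate that is the
trivial one with its blocks renamed.  The invariant notion is RELATIVE: two wired blocks `c, c'` of
the same copy read the `x`-leg «in the same orientation up to sign» iff `τ_{c+c'}` acts by a scalar
on `range A_i` (equivalently `τ_c ∘ A_i` and `τ_{c'} ∘ A_i` are proportional, `relative_iff`).

## What is proved

* `card_mul_finrank_le_of_relative` — GAUGE-FIXED CAPACITY LAW: if `τ_{c+c'}` acts by a scalar on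
  `E` for all `c, c' ∈ C`, then `|C| · dim E ≤ 6^N` (translate `C` by one of its elements into the
  scalar subgroup and apply `card_mul_finrank_le`).
* `four_pow_le_card_mul_three_pow_of_relative` — the column-disjoint no-go `4^N ≤ |ι| · 3^N`
  under the relative hypothesis only; `relative_of_signUntwisted` shows it contains the absolute
  one, and `pretwist_relative` / `pretwist_not_signUntwisted` that the containment is strict.
* `exists_incoherent_copy` — EXTREMAL READING, now relabelling-invariant: a column-disjoint
  certificate with `|ι| · 3^N < 4^N` contains a copy with two wired blocks `c, c'` whose readings
  are NOT proportional (`τ_{c+c'}` is no scalar on the `x`-leg's range): one `x`-leg used in two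
  essentially different orientations — the genuinely new mechanism a sub-`(4/3)^N` certificate must
  exhibit (or block sharing, `OutsiderSandwichSharedBlocks`).

## References

* M. Bläser, *Fast Matrix Multiplication*, Theory of Computing Graduate Surveys 5 (2013), §5.
  [Blaser2013]
* J.-P. Serre, *Linear Representations of Finite Groups*, GTM 42 (1977), §2.6 (fixed points and
  orbit counting). [Serre1977]
-/

noncomputable section

open scoped BigOperators Matrix

set_option linter.dupNamespace false
set_option autoImplicit false

namespace Summit.MatrixMultiplication.MatrixMultiplication.Theorems.OutsiderSandwichRelativeTwist

open Summit.MatrixMultiplication.MatrixMultiplication.Theorems.OutsiderSandwichTwistGluing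
  Summit.MatrixMultiplication.MatrixMultiplication.Theorems.OutsiderSandwichTwistCapacity
  Summit.MatrixMultiplication.MatrixMultiplication.Theorems.OutsiderSandwichColumnDisjoint

universe u v

variable {N : ℕ} {K : Type u} [Field K] {ι : Type v} [Fintype ι]

/-! ## 1. The gauge-fixed capacity law -/

/-- **Gauge-fixed capacity law.**  If for all `c, c' ∈ C` the RELATIVE twist `τ_{c+c'}` acts on
the subspace `E` by a scalar, then `|C| · dim E ≤ 6^N`.  (Translate `C` by one of its elements:
the translate lies in the scalar subgroup of `E`, has the same cardinality, and
`card_mul_finrank_le` applies.) -/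
theorem card_mul_finrank_le_of_relative (E : Submodule K (Matrix (Idx N) (Idx N) K))
    (C : Finset (Idx N))
    (hC : ∀ c ∈ C, ∀ c' ∈ C, ∃ ε : K, ∀ Y ∈ E, ptrans (c + c') Y = ε • Y) :
    C.card * Module.finrank K E ≤ 6 ^ N := by
  classical
  rcases C.eq_empty_or_nonempty with hCe | ⟨c₀, hc₀⟩
  · simp [hCe]
  have hinj : Function.Injective (fun c : Idx N => c + c₀) := add_left_injective c₀
  rw [← Finset.card_image_of_injective C hinj]
  refine card_mul_finrank_le E _ fun d hd => ?_
  obtain ⟨c, hc, rfl⟩ := Finset.mem_image.1 hd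
  exact hC c hc c₀ hc₀

/-- The same for the range of an `x`-leg map `A`: if `τ_{c+c'} (A X) = ε • A X` for all wired
`c, c'`, then `|C| · rank A ≤ 6^N`. -/
theorem card_mul_finrank_range_le_of_relative
    (A : Matrix (Idx N) (Idx N) K →ₗ[K] Matrix (Idx N) (Idx N) K) (C : Finset (Idx N))
    (hC : ∀ c ∈ C, ∀ c' ∈ C, ∃ ε : K, ∀ X, ptrans (c + c') (A X) = ε • A X) :
    C.card * Module.finrank K (LinearMap.range A) ≤ 6 ^ N :=
  card_mul_finrank_le_of_relative _ C fun c hc c' hc' => by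
    obtain ⟨ε, hε⟩ := hC c hc c' hc'
    refine ⟨ε, fun Y hY => ?_⟩
    obtain ⟨X, rfl⟩ := LinearMap.mem_range.1 hY
    exact hε X

/-! ## 2. Relative versus absolute sign-untwisting -/

/-- Absolute sign-untwisting of two blocks implies relative sign-untwisting of the pair
(`τ_{c+c'} = τ_{c'} ∘ τ_c`, product of the two scalars). -/
theorem relative_of_signUntwisted (A : Matrix (Idx N) (Idx N) K →ₗ[K] Matrix (Idx N) (Idx N) K)
    {c c' : Idx N} (hc : ∃ ε : K, ∀ X, ptrans c (A X) = ε • A X)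
    (hc' : ∃ ε : K, ∀ X, ptrans c' (A X) = ε • A X) :
    ∃ ε : K, ∀ X, ptrans (c + c') (A X) = ε • A X := by
  obtain ⟨ε, hε⟩ := hc
  obtain ⟨ε', hε'⟩ := hc'
  refine ⟨ε * ε', fun X => ?_⟩
  rw [← ptrans_comp, hε X, ptrans_smul, hε' X, smul_smul, mul_comm]

/-- Relative sign-untwisting of `c, c'` says exactly that the two readings `τ_c ∘ A` and `τ_{c'} ∘ A`
are proportional. -/
theorem relative_iff (A : Matrix (Idx N) (Idx N) K →ₗ[K] Matrix (Idx N) (Idx N) K)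
    (c c' : Idx N) (ε : K) :
    (∀ X, ptrans (c + c') (A X) = ε • A X) ↔ ∀ X, ptrans c (A X) = ε • ptrans c' (A X) := by
  have hcc : c' + c' = 0 := funext fun i => by
    have h : ∀ x : Fin 2, x + x = 0 := by decide
    exact h (c' i)
  constructor
  · intro h X
    have h1 := congrArg (ptrans c') (h X)
    rwa [ptrans_comp, ptrans_smul, show c + c' + c' = c by rw [add_assoc, hcc, add_zero]] at h1
  · intro h X
    have h1 := congrArg (ptrans c') (h X)
    rwa [ptrans_comp, ptrans_smul, ptrans_ptrans] at h1

/-- **The pre-twisted leg is relatively untwisted on its productive block:** for `A = τ_{c₀}` (as a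
linear map) the single wired block `c₀` satisfies the relative hypothesis trivially
(`c₀ + c₀ = 0`, `τ_0 = id`, `ε = 1`). -/
theorem pretwist_relative (c₀ : Idx N) :
    ∃ T : Matrix (Idx N) (Idx N) K →ₗ[K] Matrix (Idx N) (Idx N) K,
      (∀ X, T X = ptrans c₀ X) ∧ ∃ ε : K, ∀ X, ptrans (c₀ + c₀) (T X) = ε • T X := by
  refine ⟨{ toFun := ptrans c₀, map_add' := ptrans_add c₀, map_smul' := ptrans_smul c₀ },
    fun _ => rfl, 1, fun X => ?_⟩
  have hcc : c₀ + c₀ = 0 := funext fun i => by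
    have h : ∀ x : Fin 2, x + x = 0 := by decide
    exact h (c₀ i)
  rw [hcc, ptrans_zero, one_smul]

/-- **… but not absolutely sign-untwisted:** for `c₀ ≠ 0` (over a field) no scalar `ε` has
`τ_{c₀} (τ_{c₀} X) = ε • τ_{c₀} X` for all `X` — so the absolute no-go
`four_pow_le_card_mul_three_pow` does not see the relabelled trivial certificate, while
`four_pow_le_card_mul_three_pow_of_relative` does. -/
theorem pretwist_not_signUntwisted {c₀ : Idx N} (hc₀ : c₀ ≠ 0) :
    ¬ ∃ ε : K, ∀ X : Matrix (Idx N) (Idx N) K, ptrans c₀ (ptrans c₀ X) = ε • ptrans c₀ X := by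
  rintro ⟨ε, hε⟩
  -- `X = 1`: `1 = ε • 1`, so `ε = 1`
  have h1 : ε = 1 := by
    have h := hε 1
    rw [ptrans_one, ptrans_one] at h
    have h' := congrFun (congrFun h 0) 0
    rw [Matrix.smul_apply, Matrix.one_apply_eq, smul_eq_mul, mul_one] at h'
    exact h'.symm
  -- then `τ_{c₀} Y = Y` for all `Y` (`Y = τ_{c₀} X`), i.e. `1 · τ_{c₀} Y · 1 = Y`: impossible
  refine ptrans_not_untwistable hc₀ (1 : Matrix (Idx N) (Idx N) K) 1 fun Y => ?_
  have h := hε (ptrans c₀ Y)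
  simp only [ptrans_ptrans, h1, one_smul] at h
  rw [Matrix.one_mul, Matrix.mul_one]
  exact h

/-! ## 3. The column-disjoint no-go under relative sign-untwisting -/

/-- **CD ∧ relative-SU ⟹ `4^N ≤ B · 3^N`.**  A column-disjoint certificate (`x`-leg maps `A i`,
block `(i, c)` wired to column `col i c`, vector legs `G i c`, `H i c`, column identities `ident`)
in which any two WIRED blocks of the same copy are relatively sign-untwisted has at least
`(4/3)^N` copies.  Generalises `four_pow_le_card_mul_three_pow` (`relative_of_signUntwisted`) and is
invariant under relabelling the blocks of each copy by a translate. -/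
theorem four_pow_le_card_mul_three_pow_of_relative
    (A : ι → Matrix (Idx N) (Idx N) K →ₗ[K] Matrix (Idx N) (Idx N) K)
    (col : ι → Idx N → Option (Idx N)) (G H : ι → Idx N → Matrix (Idx N) (Idx N) K)
    (ident : ∀ (d : Idx N) (X : Matrix (Idx N) (Idx N) K),
      ∑ b ∈ Finset.univ.filter (fun b : ι × Idx N => col b.1 b.2 = some d),
        G b.1 b.2 * ptrans b.2 (A b.1 X) * H b.1 b.2 = X)
    (hRel : ∀ i c c', col i c ≠ none → col i c' ≠ none →
      ∃ ε : K, ∀ X, ptrans (c + c') (A i X) = ε • A i X) :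
    4 ^ N ≤ Fintype.card ι * 3 ^ N := by
  classical
  let rk : ι → ℕ := fun i => Module.finrank K (LinearMap.range (A i))
  let C : ι → Finset (Idx N) := fun i => Finset.univ.filter fun c => col i c ≠ none
  -- (1) per column
  have hcol : ∀ d : Idx N, 4 ^ N ≤
      ∑ b ∈ Finset.univ.filter (fun b : ι × Idx N => col b.1 b.2 = some d), rk b.1 :=
    fun d => four_pow_le_sum_finrank A G H _ (ident d)
  -- (2) summing over columns
  have hfib : ∀ b : ι × Idx N,
      ∑ d : Idx N, (if col b.1 b.2 = some d then rk b.1 else 0) =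
        if col b.1 b.2 ≠ none then rk b.1 else 0 := by
    intro b
    cases hb : col b.1 b.2 with
    | none => simp
    | some d₀ =>
        simp only [Option.some.injEq, ne_eq, reduceCtorEq, not_false_eq_true, if_true]
        rw [Finset.sum_ite_eq Finset.univ d₀ (fun _ => rk b.1), if_pos (Finset.mem_univ _)]
  have hsum : ∑ d : Idx N,
      ∑ b ∈ Finset.univ.filter (fun b : ι × Idx N => col b.1 b.2 = some d), rk b.1 =
        ∑ i, (C i).card * rk i := by
    calc ∑ d : Idx N, ∑ b ∈ Finset.univ.filter (fun b : ι × Idx N => col b.1 b.2 = some d), rk b.1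
        = ∑ d : Idx N, ∑ b : ι × Idx N, (if col b.1 b.2 = some d then rk b.1 else 0) :=
          Finset.sum_congr rfl fun d _ => Finset.sum_filter _ _
      _ = ∑ b : ι × Idx N, ∑ d : Idx N, (if col b.1 b.2 = some d then rk b.1 else 0) :=
          Finset.sum_comm
      _ = ∑ b : ι × Idx N, (if col b.1 b.2 ≠ none then rk b.1 else 0) :=
          Finset.sum_congr rfl fun b _ => hfib b
      _ = ∑ i, ∑ c : Idx N, (if col i c ≠ none then rk i else 0) :=
          Fintype.sum_prod_type _
      _ = ∑ i, (C i).card * rk i := Finset.sum_congr rfl fun i _ => by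
          rw [← Finset.sum_filter, Finset.sum_const, smul_eq_mul]
  -- (3) gauge-fixed capacity law per copy
  have hcap : ∀ i, (C i).card * rk i ≤ 6 ^ N := fun i =>
    card_mul_finrank_range_le_of_relative (A i) (C i) fun c hc c' hc' =>
      hRel i c c' (Finset.mem_filter.1 hc).2 (Finset.mem_filter.1 hc').2
  have h8 : 2 ^ N * 4 ^ N ≤ Fintype.card ι * 6 ^ N := by
    calc 2 ^ N * 4 ^ N = ∑ _d : Idx N, 4 ^ N := by rw [Finset.sum_const, Finset.card_univ,
          card_Idx, smul_eq_mul]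
      _ ≤ ∑ d : Idx N,
            ∑ b ∈ Finset.univ.filter (fun b : ι × Idx N => col b.1 b.2 = some d), rk b.1 :=
          Finset.sum_le_sum fun d _ => hcol d
      _ = ∑ i, (C i).card * rk i := hsum
      _ ≤ ∑ _i : ι, 6 ^ N := Finset.sum_le_sum fun i _ => hcap i
      _ = Fintype.card ι * 6 ^ N := by rw [Finset.sum_const, Finset.card_univ, smul_eq_mul]
  rw [show (6 : ℕ) ^ N = 2 ^ N * 3 ^ N by rw [← mul_pow]; norm_num, Nat.mul_left_comm] at h8
  exact Nat.le_of_mul_le_mul_left h8 (pow_pos two_pos N)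

/-- **Extremal reading (relabelling-invariant): an incoherent copy.**  A column-disjoint
certificate with `|ι| · 3^N < 4^N` has a copy `i` with two wired blocks `c, c'` whose readings of
the `x`-leg are not proportional: `τ_{c+c'}` is no scalar on `range (A i)`. -/
theorem exists_incoherent_copy
    (A : ι → Matrix (Idx N) (Idx N) K →ₗ[K] Matrix (Idx N) (Idx N) K)
    (col : ι → Idx N → Option (Idx N)) (G H : ι → Idx N → Matrix (Idx N) (Idx N) K)
    (ident : ∀ (d : Idx N) (X : Matrix (Idx N) (Idx N) K),
      ∑ b ∈ Finset.univ.filter (fun b : ι × Idx N => col b.1 b.2 = some d),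
        G b.1 b.2 * ptrans b.2 (A b.1 X) * H b.1 b.2 = X)
    (hlt : Fintype.card ι * 3 ^ N < 4 ^ N) :
    ∃ i c c', col i c ≠ none ∧ col i c' ≠ none ∧
      ∀ ε : K, ∃ X, ptrans (c + c') (A i X) ≠ ε • A i X := by
  by_contra h
  simp only [not_exists, not_and, not_forall, ne_eq, not_not] at h
  exact absurd (four_pow_le_card_mul_three_pow_of_relative A col G H ident
    fun i c c' hc hc' => h i c c' hc hc') (not_le.2 hlt)

end Summit.MatrixMultiplication.MatrixMultiplication.Theorems.OutsiderSandwichRelativeTwist
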